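import Summits.KontsevichZagierPeriods.KontsevichZagierPeriods.Theses.SymplecticScissors
import Literature.NumberTheory.Transcendental.KZCalculus
import Literature.NumberTheory.Transcendental.CurvePeriods
import Literature.NumberTheory.Transcendental.CurvePeriodsTransportProofs
import Literature.NumberTheory.Transcendental.AnalytificationImplicit
import Literature.NumberTheory.Transcendental.SemialgebraicMaps
import Literature.NumberTheory.Transcendental.SemialgebraicMapsProofs
import Literature.NumberTheory.Transcendental.KZSemialgebraicComplex

/-!
# Crux `SymplecticScissors.CurvePeriodsTransfer` (stmt-KontsevichZagierPeriods-11129), line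
`standard-etale-models`, stub `stub_sectionSymbol`: the section symbol on the standard-étale model

For a plane curve `G_K(s, y) = 0` with real algebraic coefficients, a polynomial `T ∈ ℚ̄[s]`, an
exponent `K` and a real-analytic `ℚ`-semialgebraic étale root branch `u` on `[0, 1]`
(`G_K(s, u s) = 0`, `∂_y G_K(s, u s) ≠ 0`, `u 0, u 1 ∈ ℚ̄`) we build the period symbol
`S = (V, ω, γ)` of curve type (Huber–Wüstholz 2022, §3.3.1) with

* `V = {G_K(x₀, x₁) = 0, x₂ · ∂₁G_K(x₀, x₁) − 1 = 0} ⊂ 𝔸³`, the STANDARD-ÉTALE MODEL: a smooth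
  affine curve over `ℚ̄` for every `G_K` (`etale_isSmoothAffineCurve`: the gradient rows are
  `(∂₀G, ∂₁G, 0)` and `(x₂∂₀∂₁G, x₂∂₁²G, ∂₁G)`, of rank `2` wherever `x₂ ∂₁G = 1`; no point is
  isolated by the holomorphic implicit function theorem `exists_implicitChart` applied to the
  two equations and the variables `x₁, x₂`, whose Jacobian minor is `(∂₁G)²`);
* `ω = (T(x₀) + x₀ᴷ x₁) dx₀`;
* `γ(s) = (s, u(s), 1/∂₁G_K(s, u(s)))`, the SECTION of `V` over the parameter line,

and check: the realified path is `ℚ`-semialgebraic on `[0,1]`, the period is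
`∫₀¹ (T(s) + sᴷ u(s)) ds`, and every representation `[∫_{(0,1)} T + sᴷ u]` realises `S` with
coefficient `1`. Everything is folklore bookkeeping around [HuberWustholz2022, §3.3.1, Cor. 12.7].
-/

noncomputable section

open scoped BigOperators Topology
open Set MeasureTheory Filter MvPolynomial
open Literature.NumberTheory.Transcendental Literature.NumberTheory.Transcendental.CurvePeriods
open Literature.ModelTheory.ExponentialFields (IsSemialgebraic)

namespace Summit.KontsevichZagierPeriods.SymplecticScissors.CurvePeriodsTransfer

/-! ## Algebraic bookkeeping -/

/-- Renaming variables preserves algebraic coefficients. [folklore] -/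
theorem hasAlgCoeffs_rename {n m : ℕ} (f : Fin n → Fin m) {P : MvPolynomial (Fin n) ℂ}
    (hP : HasAlgCoeffs P) : HasAlgCoeffs (rename f P) := by
  have h : rename f P = bind₁ (X ∘ f) P := by
    rw [← bind₁_rename, bind₁_X_left, AlgHom.id_apply]
  rw [h]
  exact hP.bind₁ fun j => hasAlgCoeffs_X (f j)

/-- A real polynomial with algebraic coefficients, mapped to `ℂ`, has algebraic coefficients.
[folklore] -/
theorem hasAlgCoeffs_map_of_isAlgebraic {n : ℕ} {Q : MvPolynomial (Fin n) ℝ}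
    (hQ : ∀ d, IsAlgebraic ℚ (Q.coeff d)) : HasAlgCoeffs (map (algebraMap ℝ ℂ) Q) := fun d => by
  rw [coeff_map]
  exact (hQ d).algebraMap

/-- Partial derivatives of a real polynomial with algebraic coefficients have algebraic
coefficients. [folklore] -/
theorem isAlgebraic_coeff_pderiv {n : ℕ} {Q : MvPolynomial (Fin n) ℝ}
    (hQ : ∀ d, IsAlgebraic ℚ (Q.coeff d)) (i : Fin n) :
    ∀ d, IsAlgebraic ℚ ((pderiv i Q).coeff d) := fun d => by
  rw [coeff_pderiv]
  exact (hQ _).mul ((isAlgebraic_nat _).add isAlgebraic_one)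

/-- A real polynomial with algebraic coefficients takes algebraic values at algebraic points.
[folklore] -/
theorem isAlgebraic_eval_real {n : ℕ} {Q : MvPolynomial (Fin n) ℝ}
    (hQ : ∀ d, IsAlgebraic ℚ (Q.coeff d)) {x : Fin n → ℝ} (hx : ∀ i, IsAlgebraic ℚ (x i)) :
    IsAlgebraic ℚ (eval x Q) := by
  rw [eval_eq']
  exact Finset.sum_induction _ (IsAlgebraic ℚ) (fun _ _ ha hb => ha.add hb) isAlgebraic_zero
    fun d _ => (hQ d).mul (Finset.prod_induction _ (IsAlgebraic ℚ) (fun _ _ ha hb => ha.mul hb)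
      isAlgebraic_one fun i _ => (hx i).pow _)

/-- Evaluation of a real polynomial mapped to `ℂ` at a real point. [folklore] -/
theorem eval_map_ofReal {n : ℕ} (Q : MvPolynomial (Fin n) ℝ) (x : Fin n → ℝ) :
    eval (fun i => (x i : ℂ)) (map (algebraMap ℝ ℂ) Q) = ((eval x Q : ℝ) : ℂ) := by
  induction Q using MvPolynomial.induction_on with
  | C a => simp
  | add p q hp hq => simp [hp, hq]
  | mul_X p i hp => simp [hp]

/-- Evaluation of `G(x₀, x₁)` (a real polynomial in the first two of three variables) at a real
point `(a, b, c)`. [folklore] -/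
theorem eval_rename_ofReal (Q : MvPolynomial (Fin 2) ℝ) (a b c : ℝ) :
    eval ![(a : ℂ), (b : ℂ), (c : ℂ)] (rename Fin.castSucc (map (algebraMap ℝ ℂ) Q)) =
      ((eval ![a, b] Q : ℝ) : ℂ) := by
  have h : ((![(a : ℂ), (b : ℂ), (c : ℂ)] : Fin 3 → ℂ) ∘ Fin.castSucc) =
      fun i => ((![a, b] : Fin 2 → ℝ) i : ℂ) := by
    funext k
    fin_cases k <;> rfl
  rw [eval_rename, h, eval_map_ofReal]

/-! ## The standard-étale model is a smooth affine curve over `ℚ̄` -/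

/-- **The standard-étale model `V_G = {G(x₀,x₁) = 0, x₂ ∂₁G(x₀,x₁) = 1} ⊂ 𝔸³` is a smooth affine
curve over `ℚ̄`** for every `G ∈ ℚ̄[x₀, x₁]`: the gradient rows `(∂₀G, ∂₁G, 0)`,
`(x₂∂₀∂₁G, x₂∂₁²G, ∂₁G)` are independent wherever `x₂∂₁G = 1`, and through every point passes the
holomorphic implicit-function branch over the coordinate `x₀` (Jacobian minor `(∂₁G)²` in the
variables `x₁, x₂`). [cite: HuberWustholz2022, §3.3.1] -/
theorem etale_isSmoothAffineCurve (G : MvPolynomial (Fin 2) ℂ) (hG : HasAlgCoeffs G) :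
    (⟨3, 2, ![rename Fin.castSucc G, X 2 * rename Fin.castSucc (pderiv 1 G) - 1]⟩ :
      CurveData).IsSmoothAffineCurve := by
  set F : Fin 2 → MvPolynomial (Fin 3) ℂ :=
    ![rename Fin.castSucc G, X 2 * rename Fin.castSucc (pderiv 1 G) - 1]
  have hinj : Function.Injective (Fin.castSucc : Fin 2 → Fin 3) := Fin.castSucc_injective 2
  -- partial derivatives of the two equations
  have h2 : ∀ Q : MvPolynomial (Fin 2) ℂ,
      pderiv 2 (rename Fin.castSucc Q : MvPolynomial (Fin 3) ℂ) = 0 := fun Q => by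
    refine pderiv_eq_zero_of_notMem_vars fun h => ?_
    obtain ⟨i, -, hi⟩ := mem_vars_rename _ _ h
    exact (Fin.castSucc_lt_last i).ne hi
  have hd01 : pderiv 1 (F 0) = rename Fin.castSucc (pderiv 1 G) := pderiv_rename hinj 1 G
  have hd02 : pderiv 2 (F 0) = 0 := h2 G
  have hd12 : pderiv 2 (F 1) = rename Fin.castSucc (pderiv 1 G) := by
    show pderiv 2 (X 2 * rename Fin.castSucc (pderiv 1 G) - 1) = _
    rw [map_sub, pderiv_mul, pderiv_X_self, h2, pderiv_one]
    simp
  -- `∂₁G ≠ 0` on `V`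
  have hD : ∀ z : Fin 3 → ℂ, (∀ j, eval z (F j) = 0) →
      eval (z ∘ Fin.castSucc) (pderiv 1 G) ≠ 0 := fun z hz => by
    have h := hz 1
    change eval z (X 2 * rename Fin.castSucc (pderiv 1 G) - 1) = 0 at h
    rw [map_sub, map_mul, eval_X, map_one, eval_rename, sub_eq_zero] at h
    exact right_ne_zero_of_mul_eq_one h
  refine ⟨fun j => ?_, fun z hz => ?_, fun z hz => ?_⟩
  · -- the equations are over `ℚ̄`
    fin_cases j
    · exact hasAlgCoeffs_rename _ hG
    · exact ((hasAlgCoeffs_X 2).mul (hasAlgCoeffs_rename _ (hG.pderiv 1))).sub hasAlgCoeffs_one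
  · -- Jacobian criterion
    have hzF : ∀ j, eval z (F j) = 0 := CurveData.mem_points.1 hz
    have hDz := hD z hzF
    have g01 : CurveData.gradient ⟨3, 2, F⟩ 0 z 1 = eval (z ∘ Fin.castSucc) (pderiv 1 G) := by
      show eval z (pderiv 1 (F 0)) = _
      rw [hd01, eval_rename]
    have g02 : CurveData.gradient ⟨3, 2, F⟩ 0 z 2 = 0 := by
      show eval z (pderiv 2 (F 0)) = _
      rw [hd02, map_zero]
    have g12 : CurveData.gradient ⟨3, 2, F⟩ 1 z 2 = eval (z ∘ Fin.castSucc) (pderiv 1 G) := by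
      show eval z (pderiv 2 (F 1)) = _
      rw [hd12, eval_rename]
    have hli : LinearIndependent ℂ (fun j => CurveData.gradient ⟨3, 2, F⟩ j z) := by
      rw [linearIndependent_fin2]
      refine ⟨fun h => hDz ?_, fun a h => hDz ?_⟩
      · have h' := congrFun h 2
        rwa [g12] at h'
      · have ha := congrFun h 2
        rw [Pi.smul_apply, smul_eq_mul, g12, g02] at ha
        have ha0 : a = 0 := (mul_eq_zero.1 ha).resolve_right hDz
        have h1 := congrFun h 1
        rw [Pi.smul_apply, smul_eq_mul, ha0, zero_mul, g01] at h1
        exact h1.symm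
    rw [finrank_span_eq_card hli]
    simp
  · -- no isolated points: the implicit-function branch over `x₀`
    classical
    have hzF : ∀ j, eval z (F j) = 0 := CurveData.mem_points.1 hz
    have hDz := hD z hzF
    obtain ⟨E, hE1, hE2⟩ : ∃ E : Fin 1 ⊕ Fin 2 ≃ Fin 3, E (Sum.inr 0) = 1 ∧ E (Sum.inr 1) = 2 :=
      ⟨finSumFinEquiv, rfl, rfl⟩
    have hJ : (Matrix.of fun i j : Fin 2 => eval z (pderiv (E (Sum.inr i)) (F j))).det ≠ 0 := by
      rw [Matrix.det_fin_two]
      simp only [Matrix.of_apply, hE1, hE2, hd01, hd02, hd12, map_zero, mul_zero, sub_zero,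
        eval_rename]
      exact mul_ne_zero hDz hDz
    obtain ⟨Ω, T, ψ, -, hzΩ, hTo, hψ, hP1, hP2⟩ := exists_implicitChart E F z hJ
    obtain ⟨hw₀T, hψw₀⟩ := hP1 z hzΩ hzF
    haveI : Filter.NeBot (𝓝[≠] fun t : Fin 1 => z (E (Sum.inl t))) :=
      Module.punctured_nhds_neBot ℂ (Fin 1 → ℂ) _
    have ht : Tendsto ψ (𝓝[≠] fun t : Fin 1 => z (E (Sum.inl t))) (𝓝 z) := by
      have h := (hψ _ hw₀T).continuousAt.tendsto
      rw [hψw₀] at h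
      exact h.mono_left nhdsWithin_le_nhds
    refine mem_closure_of_tendsto ht ?_
    filter_upwards [mem_nhdsWithin_of_mem_nhds (hTo.mem_nhds hw₀T), self_mem_nhdsWithin]
      with w hwT hw
    obtain ⟨-, hwF, hproj⟩ := hP2 w hwT
    refine ⟨hwF, fun heq => hw ?_⟩
    have heq' : ψ w = z := heq
    show w = fun t => z (E (Sum.inl t))
    rw [← hproj, heq']

/-! ## Real-analytic and semialgebraic bookkeeping for the section -/

/-- A real polynomial in `(t, u(t))` is as smooth as `u`. [folklore] -/
theorem contDiffOn_eval_pair {s : Set ℝ} {u : ℝ → ℝ} {n : WithTop ℕ∞} (hu : ContDiffOn ℝ n u s)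
    (Q : MvPolynomial (Fin 2) ℝ) : ContDiffOn ℝ n (fun t => eval ![t, u t] Q) s := by
  induction Q using MvPolynomial.induction_on with
  | C a => simpa using contDiffOn_const
  | add p q hp hq => simpa using hp.add hq
  | mul_X p i hp =>
    fin_cases i
    · simpa using hp.mul contDiffOn_id
    · simpa using hp.mul hu

/-- Powers of real semialgebraic functions are semialgebraic. [folklore] -/
theorem isSemialgebraicFunOn_pow {m : ℕ} {s : Set (Fin m → ℝ)} (hs : IsSemialgebraic ℚ s)
    {f : (Fin m → ℝ) → ℝ} (hf : IsSemialgebraicFunOn ℚ s f) :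
    ∀ n : ℕ, IsSemialgebraicFunOn ℚ s (fun x => f x ^ n)
  | 0 => by simpa using isSemialgebraicFunOn_natCast hs 1
  | n + 1 => (IsSemialgebraicFunOn.mul_holds (isSemialgebraicFunOn_pow hs hf n) hf).congr
      fun x _ => by simp [pow_succ]

/-- A real polynomial with ALGEBRAIC coefficients in two `ℚ`-semialgebraic functions is
`ℚ`-semialgebraic (algebraic constants are `ℚ`-definable,
`isSemialgebraicFunOn_const_of_isAlgebraic`; sums and products by Tarski–Seidenberg).
[folklore] -/
theorem isSemialgebraicFunOn_eval_pair {m : ℕ} {s : Set (Fin m → ℝ)} (hs : IsSemialgebraic ℚ s)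
    (Q : MvPolynomial (Fin 2) ℝ) (hQ : ∀ d, IsAlgebraic ℚ (Q.coeff d)) {f g : (Fin m → ℝ) → ℝ}
    (hf : IsSemialgebraicFunOn ℚ s f) (hg : IsSemialgebraicFunOn ℚ s g) :
    IsSemialgebraicFunOn ℚ s (fun x => eval ![f x, g x] Q) := by
  classical
  have hsum : ∀ S : Finset (Fin 2 →₀ ℕ),
      IsSemialgebraicFunOn ℚ s (fun x => ∑ d ∈ S, Q.coeff d * (f x ^ d 0 * g x ^ d 1)) := by
    intro S
    induction S using Finset.induction_on with
    | empty => simpa using isSemialgebraicFunOn_natCast hs 0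
    | insert a S ha ih =>
      have h := IsSemialgebraicFunOn.add_holds (IsSemialgebraicFunOn.mul_holds
        (isSemialgebraicFunOn_const_of_isAlgebraic hs (hQ a)) (IsSemialgebraicFunOn.mul_holds
          (isSemialgebraicFunOn_pow hs hf (a 0)) (isSemialgebraicFunOn_pow hs hg (a 1)))) ih
      refine h.congr fun x _ => ?_
      simp [Finset.sum_insert ha]
  refine (hsum Q.support).congr fun x _ => ?_
  simp [MvPolynomial.eval_eq', Fin.prod_univ_two]

/-! ## The section symbol -/

/-- **The section symbol on the standard-étale model** (stub `stub_sectionSymbol` of the line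
`standard-etale-models`): for `G_K ∈ ℚ̄[s,y]` with real algebraic coefficients, `T ∈ ℚ̄[s]`, `K`,
and `u` analytic at every point of `[0,1]`, `ℚ`-semialgebraic on `[0,1]`, with `G_K(s, u(s)) = 0`,
`∂_yG_K(s, u(s)) ≠ 0` on `[0,1]` and `u(0), u(1) ∈ ℚ̄`, the symbol `S = (V, ω, γ)` —
`V = {G_K = 0, x₂·∂₁G_K = 1} ⊂ 𝔸³`, `ω = (T(x₀) + x₀ᴷ x₁) dx₀`, `γ(s) = (s, u(s), 1/∂₁G_K(s,u(s)))`
— is a period symbol of curve type along a `ℚ`-semialgebraic path, with period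
`∫₀¹ (T(s) + sᴷu(s)) ds`, realised with coefficient `1` by every representation
`[∫_{(0,1)} T + sᴷu]`. [cite: HuberWustholz2022, §3.3.1] -/
theorem stub_sectionSymbol : ∀ (GK : MvPolynomial (Fin 2) ℝ) (T : Polynomial ℝ) (K : ℕ) (u : ℝ → ℝ),
    (∀ d, IsAlgebraic ℚ (GK.coeff d)) → (∀ i, IsAlgebraic ℚ (T.coeff i)) →
    (∀ s ∈ Set.Icc (0 : ℝ) 1, AnalyticAt ℝ u s) →
    IsSemialgebraicFunOn ℚ {z : Fin 1 → ℝ | z 0 ∈ Set.Icc (0 : ℝ) 1} (fun z => u (z 0)) →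
    (∀ s ∈ Set.Icc (0 : ℝ) 1, MvPolynomial.eval ![s, u s] GK = 0) →
    (∀ s ∈ Set.Icc (0 : ℝ) 1, MvPolynomial.eval ![s, u s] (MvPolynomial.pderiv 1 GK) ≠ 0) →
    IsAlgebraic ℚ (u 0) → IsAlgebraic ℚ (u 1) →
    ∃ S : PeriodSymbol,
      S.Z = (⟨3, 2, ![MvPolynomial.rename Fin.castSucc (MvPolynomial.map (algebraMap ℝ ℂ) GK),
        MvPolynomial.X 2 * MvPolynomial.rename Fin.castSucc
          (MvPolynomial.pderiv 1 (MvPolynomial.map (algebraMap ℝ ℂ) GK)) - 1]⟩ : CurveData) ∧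
      IsSemialgebraicMapOn ℚ {z : Fin 1 → ℝ | z 0 ∈ Set.Icc (0 : ℝ) 1}
        (fun z => Fin.append (fun i => (S.γ.toFun (z 0) i).re) (fun i => (S.γ.toFun (z 0) i).im)) ∧
      S.period = ((∫ s in (0 : ℝ)..1, (Polynomial.eval s T + s ^ K * u s) : ℝ) : ℂ) ∧
      ∀ r : KZ.IntegralRep 1, r.domain = {z | z 0 ∈ Set.Ioo (0 : ℝ) 1} →
        (∀ z ∈ r.domain, r.integrand z = Polynomial.eval (z 0) T + (z 0) ^ K * u (z 0)) →
        (r.domain = {z | z 0 ∈ Set.Ioo (0 : ℝ) 1} ∧ ∀ z ∈ r.domain, r.integrand z =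
          ((1 : ℂ) * ∑ i, MvPolynomial.eval (S.γ.toFun (z 0)) (S.ω i) *
            deriv (fun t => S.γ.toFun t i) (z 0)).re) := by
  intro GK T K u hGK hT hu_an hu_sa hG0 hG1 hu0 hu1
  -- the complex equations and the smooth model
  have hGc : HasAlgCoeffs (map (algebraMap ℝ ℂ) GK) := hasAlgCoeffs_map_of_isAlgebraic hGK
  have hV := etale_isSmoothAffineCurve _ hGc
  -- the real section `s ↦ (s, u s, 1 / p s)`, `p s = ∂₁G_K(s, u s)`
  have hu_cd : ContDiffOn ℝ 1 u (Set.Icc 0 1) := fun s hs =>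
    (hu_an s hs).contDiffAt.contDiffWithinAt
  have hp_cd : ContDiffOn ℝ 1 (fun t => eval ![t, u t] (pderiv 1 GK)) (Set.Icc 0 1) :=
    contDiffOn_eval_pair hu_cd _
  have hp_alg : ∀ d, IsAlgebraic ℚ ((pderiv 1 GK).coeff d) := isAlgebraic_coeff_pderiv hGK 1
  have hmapd : pderiv 1 (map (algebraMap ℝ ℂ) GK) = map (algebraMap ℝ ℂ) (pderiv 1 GK) :=
    pderiv_map
  let γ : CurvePath ⟨3, 2, ![rename Fin.castSucc (map (algebraMap ℝ ℂ) GK),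
      X 2 * rename Fin.castSucc (pderiv 1 (map (algebraMap ℝ ℂ) GK)) - 1]⟩ :=
    { toFun := fun t => ![(t : ℂ), (u t : ℂ), (((eval ![t, u t] (pderiv 1 GK))⁻¹ : ℝ) : ℂ)]
      contDiffOn := by
        refine contDiffOn_pi.2 fun i => ?_
        fin_cases i
        · exact Complex.ofRealCLM.contDiff.comp_contDiffOn contDiffOn_id
        · exact Complex.ofRealCLM.contDiff.comp_contDiffOn hu_cd
        · exact Complex.ofRealCLM.contDiff.comp_contDiffOn (hp_cd.inv hG1)
      mem_points := fun t ht => by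
        refine CurveData.mem_points.2 fun j => ?_
        fin_cases j
        · show eval _ (rename Fin.castSucc (map (algebraMap ℝ ℂ) GK)) = 0
          rw [eval_rename_ofReal, hG0 t ht, Complex.ofReal_zero]
        · show eval _ (X 2 * rename Fin.castSucc (pderiv 1 (map (algebraMap ℝ ℂ) GK)) - 1) = 0
          rw [map_sub, map_mul, eval_X, map_one, hmapd, eval_rename_ofReal, sub_eq_zero]
          simp only [Matrix.cons_val_two, Matrix.tail_cons, Matrix.head_cons]
          rw [← Complex.ofReal_mul, inv_mul_cancel₀ (hG1 t ht), Complex.ofReal_one]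
      algebraic_zero := fun i => by
        have h0 : IsAlgebraic ℚ (eval ![0, u 0] (pderiv 1 GK)) :=
          isAlgebraic_eval_real hp_alg fun i => by fin_cases i; exacts [isAlgebraic_zero, hu0]
        fin_cases i
        · show IsAlgebraic ℚ (((0 : ℝ)) : ℂ)
          rw [Complex.ofReal_zero]
          exact isAlgebraic_zero
        · show IsAlgebraic ℚ ((u 0 : ℝ) : ℂ)
          exact hu0.algebraMap
        · show IsAlgebraic ℚ ((((eval ![0, u 0] (pderiv 1 GK))⁻¹ : ℝ)) : ℂ)
          exact h0.inv.algebraMap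
      algebraic_one := fun i => by
        have h1 : IsAlgebraic ℚ (eval ![1, u 1] (pderiv 1 GK)) :=
          isAlgebraic_eval_real hp_alg fun i => by fin_cases i; exacts [isAlgebraic_one, hu1]
        fin_cases i
        · show IsAlgebraic ℚ (((1 : ℝ)) : ℂ)
          rw [Complex.ofReal_one]
          exact isAlgebraic_one
        · show IsAlgebraic ℚ ((u 1 : ℝ) : ℂ)
          exact hu1.algebraMap
        · show IsAlgebraic ℚ ((((eval ![1, u 1] (pderiv 1 GK))⁻¹ : ℝ)) : ℂ)
          exact h1.inv.algebraMap }
  have hγ : γ.toFun = fun t : ℝ =>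
      (![(t : ℂ), (u t : ℂ), (((eval ![t, u t] (pderiv 1 GK))⁻¹ : ℝ) : ℂ)] : Fin 3 → ℂ) := rfl
  -- the form `(T(x₀) + x₀ᴷ x₁) dx₀`
  obtain ⟨ω₀, hω₀⟩ : ∃ ω₀ : MvPolynomial (Fin 3) ℂ,
      ω₀ = ∑ i ∈ T.support, C ((T.coeff i : ℝ) : ℂ) * X 0 ^ i + X 0 ^ K * X 1 := ⟨_, rfl⟩
  have hω : ∀ i, HasAlgCoeffs ((![ω₀, 0, 0] : Fin 3 → MvPolynomial (Fin 3) ℂ) i) := by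
    intro i
    fin_cases i
    · show HasAlgCoeffs ω₀
      rw [hω₀]
      exact (hasAlgCoeffs_finsetSum _ _ fun i _ =>
        (hasAlgCoeffs_C (hT i).algebraMap).mul ((hasAlgCoeffs_X 0).pow i)).add
        (((hasAlgCoeffs_X 0).pow K).mul (hasAlgCoeffs_X 1))
    · exact hasAlgCoeffs_zero
    · exact hasAlgCoeffs_zero
  -- the integrand of the period: `ω₀(γ s) · 1 = T(s) + sᴷ u(s)`
  have hint : ∀ s : ℝ, ∑ i : Fin 3, eval (γ.toFun s) ((![ω₀, 0, 0] : Fin 3 → _) i) *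
      deriv (fun t => γ.toFun t i) s = ((Polynomial.eval s T + s ^ K * u s : ℝ) : ℂ) := by
    intro s
    have hd : deriv (fun t : ℝ => γ.toFun t 0) s = 1 := by
      have e : (fun t : ℝ => γ.toFun t 0) = ⇑Complex.ofRealCLM := by
        funext t
        simp [hγ]
      rw [e, (Complex.ofRealCLM.hasDerivAt (x := s)).deriv]
      simp
    rw [Fin.sum_univ_three, hd]
    simp only [Matrix.cons_val_zero, Matrix.cons_val_one, Matrix.head_cons, Matrix.cons_val_two,
      Matrix.tail_cons, map_zero, zero_mul, add_zero, mul_one]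
    rw [hω₀, hγ]
    simp [Polynomial.eval_eq_sum, Polynomial.sum_def]
  refine ⟨⟨_, hV, ![ω₀, 0, 0], hω, γ⟩, rfl, ?_, ?_, ?_⟩
  · -- the realified section is `ℚ`-semialgebraic on `[0,1]`
    have hdom : IsSemialgebraic ℚ {z : Fin 1 → ℝ | z 0 ∈ Set.Icc (0 : ℝ) 1} :=
      IsSemialgebraicFunOn.isSemialgebraic_holds hu_sa
    have hp_sa : IsSemialgebraicFunOn ℚ {z : Fin 1 → ℝ | z 0 ∈ Set.Icc (0 : ℝ) 1}
        (fun z => eval ![z 0, u (z 0)] (pderiv 1 GK)) :=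
      isSemialgebraicFunOn_eval_pair hdom _ hp_alg
        ((isSemialgebraicFunOn_aeval hdom (X 0)).congr fun z _ => by simp) hu_sa
    show IsSemialgebraicMapOn ℚ {z : Fin 1 → ℝ | z 0 ∈ Set.Icc (0 : ℝ) 1}
      (fun z => Fin.append (m := 3) (n := 3) (fun i => (γ.toFun (z 0) i).re)
        (fun i => (γ.toFun (z 0) i).im))
    refine IsSemialgebraicMapOn.of_forall hdom fun j => ?_
    refine Fin.addCases (fun i => ?_) (fun i => ?_) j
    · simp only [Fin.append_left, hγ]
      fin_cases i
      · exact (isSemialgebraicFunOn_aeval hdom (X 0)).congr fun z _ => by simp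
      · exact hu_sa.congr fun z _ => by simp
      · exact (hp_sa.inv fun z hz => hG1 _ hz).congr fun z _ => by simp
    · simp only [Fin.append_right, hγ]
      fin_cases i <;> exact (isSemialgebraicFunOn_natCast hdom 0).congr fun z _ => by simp
  · -- the period
    show (∫ s in (0 : ℝ)..1, ∑ i : Fin 3, eval (γ.toFun s) ((![ω₀, 0, 0] : Fin 3 → _) i) *
      deriv (fun t => γ.toFun t i) s) = _
    simp_rw [hint]
    exact intervalIntegral.integral_ofReal
  · -- realisation with coefficient `1`
    intro r hr hri
    refine ⟨hr, fun z hz => ?_⟩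
    rw [hri z hz]
    show _ = ((1 : ℂ) * ∑ i : Fin 3, eval (γ.toFun (z 0)) ((![ω₀, 0, 0] : Fin 3 → _) i) *
      deriv (fun t => γ.toFun t i) (z 0)).re
    rw [hint, one_mul, Complex.ofReal_re]

end Summit.KontsevichZagierPeriods.SymplecticScissors.CurvePeriodsTransfer

end
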